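import Literature.MathematicalPhysics.QuantumFieldTheory.BalabanImbrieJaffe1984to88.BIJ88LocDeriv230FlatTorus

/-!
# `BalabanImbrieJaffe1984to88.BIJ88LocDeriv231FlatTorus` — T. Bałaban, J. Imbrie, A. Jaffe, *Effective action and cluster properties of
the abelian Higgs model*, Commun. Math. Phys. **114** (1988) 257–315 [BalabanImbrieJaffe1988], Sect. 2 p. 263 [PDF 7], the sentence after
(2.33): *"Bounds analogous to (2.30), (2.31) hold for covariant derivatives and Hölder derivatives of G_{k,loc}(u) of order less than two"* —
**THE COVARIANT-DERIVATIVE MEMBER OF (2.31) AT EVERY PURE-GAUGE BACKGROUND `u = 1^h` FOR THE PRINTED LOCALIZATION DATA** (the torus cubes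
`{□_α}`, weights `λ_α` of (2.27) and cut-off `ζ″` of (2.29) of gen 26's `BIJ88LocWeights227Torus`): on every bond deep inside the no-wrap box
`Ω₀`, `D^ε_{1^h}(G_{k,loc}(1^h)f) − D^ε_{1^h}(G_k(Ω₀,1^h)f)` obeys the (2.31)-type bound
`(L^kε)·C·[m(1 + L^k((R₀−R₁)⁻¹ + s⁻¹))e^{−δ₀(2R−1)/L^k} + (1 + L^k(R₀−R₁)⁻¹)e^{−(δ₀/2)(R₁−1)/L^k}]·e^{−(δ₀/2) dist(suppt f, x)/L^k}‖f‖_∞` — the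
companion of this seat's `BIJ88LocDeriv230FlatTorus` ((2.30)-analogue).

statement-level skeleton of published theorems with citation tags; proofs where landed; nothing here is a claim about the Yang–Mills mass gap

PDF held: `paper:balaban1988-cmp114-bij-abelian-higgs-effective-action` (journal page = PDF page + 256); p. 263 [PDF 7] re-read this session
from the text layer (`lit read … --pages 7-8`).

CITATION HEADER (lean-in-tree rule).  Part of the lit-balaban TYPED SKELETON (HOME `run/shared/lean/pub/lit-balaban/`), PHASE-2 proof seat
p29 gen 27 (unit `lit-balaban-p29-g27`; TAKING line HOME/STATUS.md; free-target protocol G.5-34(d) — the owner's `C2S14-CLOSURE.md` §5 item 2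
remainder *"derivative/Hölder members of G_{k,loc} itself"*, second half).  Rows **C2.Eq2.31** second clause / the p. 263 sentence (owner r18;
abstract hence-step p08's `BIJ88HolderDecay230.holderOpClose231`, real kernels with displayed Lipschitz hypotheses; [6]'s (1.11)–(1.12)
members for the torus cubes are p31's `BIJ88DeltaLocFlatClose235.close112_flat_cube_level` / `close112_flat_cube_deriv_level`).  This file
supplies the (2.31)-DERIVATIVE MEMBER FOR `G_{k,loc}` ITSELF, for the data.  Kind: theorems only (no definition, no `Prop`-valued fact;
p31's / p13's / gen 26–27's declarations used BY NAME).

THE PRINTED TEXT (verbatim, p. 263).  *"|(G_{k,loc}(u)f − G_k(Ω,u)f)(x)| ≦ e^{−cr(e_k)}e^{−c dist(suppt f,x)}‖f‖_∞, (2.31) for dist(x,Ω^c) ≧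
O(r(e_k)). [Each G_k(□_α,u) is close to G_k(Ω,u) for the relevant x₁, x₂, therefore the convex combination and G_{k,loc} are close also.] …
Bounds analogous to (2.30), (2.31) hold for covariant derivatives and Holder derivatives of G_{k,loc}(u) of order less than two."*

THE MECHANISM (ours, declared; the printed sentence gives none beyond *"analogous"*).  With the row sources `g_{x,α}(y) = ζ″(x,y)λ_α(x,y)f(y)`
and the tails `q_x(y) = (ζ″(x,y) − 1)f(y)` of p31's `gLocT_sub_mulVec_apply` (which needs `Σ_αλ_α(x,·) = 1` on the support of `ζ″(x,·)` —
gen 26's row hypothesis (i)), on the bond `b = ⟨x, x′ = x+e_μ⟩` (`covD_gLocT_sub_apply`):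
`D(G_{k,loc}f)(b) − D(G_{Ω₀}f)(b) = Σ_α [D((G_α − G_{Ω₀})g_{x′,α})(b)] + Σ_α ε⁻¹((G_α − G_{Ω₀})(g_{x′,α} − g_{x,α}))(x) + D(G_{Ω₀}q_{x′})(b)
+ ε⁻¹(G_{Ω₀}(q_{x′} − q_x))(x)`.  Term 1 is [6]'s (1.11)–(1.12) covariant-derivative member for the cubes active at `x′` (both endpoints and the
source inside the cube, the source and `x` at sup-torus distance `≥ R`, `≥ R − 1` from `Ω₀ ∖ □_α` by gen 26's row hypothesis (ii) and the one-step
lemma), term 2 its value member on the DIFFERENCE sources (sup `≤ Λ‖f‖_∞`, `Λ = K_σ/(R₀−R₁) + 3π(d+1)/(2s)`, this seat's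
`norm_rowSource_sub_le`), term 3 is [6]'s (1.10) derivative member on `Ω₀` for the tail `q_{x′}`, supported where `ζ″(x′,·) ≠ 1`, i.e. at
sup-torus distance `> R₁` from `x′` (row hypothesis (iii)), hence `> R₁ − 1` from `x`, and term 4 its value member on the tail difference
`(ζ″(x′,·) − ζ″(x,·))f`, of sup `≤ (K_σ/(R₀−R₁))‖f‖_∞` and the same support bound.  The multiplicities are gen 26's block count `m`, and
`ε⁻¹(L^kε)² = (L^kε)L^k`.

WHAT IS PROVED (theorems only; 0 `sorry`; standard axioms).
* §1 `covD_gLocT_sub_apply` (the four-term bond identity above; any background, any data with complete weights on the two rows),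
  `norm_tail_le` / `norm_tailDiff_le` (sup bounds of the tails), support lemmas `T_gt_of_tail_ne_zero` / `T_gt_of_tailDiff_ne_zero`.
* §2 **`deriv231_flat_cwt`** — THERE EXIST `δ₀, c₀ > 0` depending on `(d, ℓ, a)` only such that for every volume, every `1 ≤ k ≤ K`, every
  no-wrap box `Ω₀` shorter than the torus leaving a torus gap `≥ R`, cube spacing `s ≥ 1`, half-width `W ≥ 2s/3 + R₀/2 + R`, radii `1 < R`,
  `0 ≤ R₁ < R₀`, every pure gauge `h`, every bond `⟨x, x+e_μ⟩` with both endpoints in `Ω₀` at chart depth `≥ R₀`, and every `f` with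
  `‖f‖_∞ ≤ F` supported at sup-torus distance `≥ D ≥ 0` from `x`:
  `‖D^ε_{1^h}(G_{k,loc}(1^h)f)(b) − D^ε_{1^h}(G_k(Ω₀,1^h)f)(b)‖ ≤
   (L^kε)·c₀·[m(1 + L^k((R₀−R₁)⁻¹ + s⁻¹))·e^{−δ₀(2R−1)/L^k} + (1 + L^k(R₀−R₁)⁻¹)·e^{−(δ₀/2)(R₁−1)/L^k}]·e^{−(δ₀/2)D/L^k}·F`,
  `m = (⌊(L^k − 1 + R₀)/s⌋ + 3)^{d+1}` — at the printed radii (`R, R₁ ~ r(e_k)L^k`, `s, R₀ − R₁ ~ r(e_{k−1})L^k/L`) the bracket is `e^{−cr(e_k)}`: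
  the printed *"bounds analogous to (2.31) … for covariant derivatives"* of `G_{k,loc}` at flat `u`, for the printed localization, in [6]'s
  derivative scale `(L^kε)`.
HONEST SCOPE.  (i) FLAT / PURE-GAUGE BACKGROUNDS ONLY.  (ii) HÖLDER quotients (and anything of order `> 1`) are NOT here.  (iii) Both endpoints
at chart depth `≥ R₀` in the no-wrap box `Ω₀` (the printed *"dist(x,Ω^c) ≧ O(r(e_k))"*), `R > 1`.  (iv) The explicit factors
`1 + L^k((R₀−R₁)⁻¹ + s⁻¹)`, `e^{−δ₀(2R−1)/L^k}`, `e^{−(δ₀/2)(R₁−1)/L^k}` replace print's `e^{−cr(e_k)}` (honest dependence on the free radii);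
`K_σ` by compactness, not computed.  (v) `j = 0`, window `a₋ = a₊ = a`, constants not optimized; Lipschitz profile of p13 for `λ_α`.
Imports: this seat's `BIJ88LocDeriv230FlatTorus` (→ gen 26 `BIJ88LocWeights227Torus` → p31 `BIJ88DeltaLocFlatClose235`; p13; p11 `BIJ85Ineq722Torus`;
p39 `B3Bound323ZeroTorus`).  Literature + Mathlib only.  Unit `lit-balaban-p29` (literature-prover-lit-balaban-p29-g27-0), 2026-08-22.  NOT
summit progress.
-/

open scoped BigOperators Matrix ComplexConjugate
open Finset Matrix

namespace Literature.MathematicalPhysics.QuantumFieldTheory.BalabanImbrieJaffe1984to88.BIJ88LocDeriv231FlatTorus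

open Literature.MathematicalPhysics.QuantumFieldTheory.Balaban1983to89
open BIJ88Sect3Statements (U1 toC cfg covD)
open BIJ85BlockAveragesTorus BIJ85BlockAveragesTorusK
open BIJ88NeumannPropagator227Torus (gBox)
open BIJ88DeltaLoc234Torus (gLocT)
open BIJ88NeumannPropagatorFlatDecayCube
open BIJ88NeumannPropagatorFlatClose231 (gLocT_mulVec_apply gLocT_sub_mulVec_apply norm_rowSource_le rowSource_ne_zero abs_lam_le_one)
open BIJ88DeltaLocFlatClose235 (decay110_flat_cube_level decay110_flat_cube_deriv_level close112_flat_cube_level close112_flat_cube_deriv_level)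
open BIJ88Cutoffs21 (cutoff cutoff_nonneg cutoff_le_one)
open BIJ88LocWeights227Torus
open BIJ88LocDeriv230FlatTorus (exists_abs_cutoff_sub_le T_shift_le_one abs_T_shift_sub_le norm_rowSource_sub_le)
open GaugeField (gaugeAct)

noncomputable section

variable {d : ℕ} {P : Params}

/-! ## §1 The four-term bond identity and the tails -/

section Identity

/-- **`D(G_{k,loc}f)(b) − D(G₀f)(b) = Σ_α D((G_α − G₀)g_{b₊,α})(b) + Σ_α ε⁻¹((G_α − G₀)(g_{b₊,α} − g_{b₋,α}))(b₋) + D(G₀q_{b₊})(b) + ε⁻¹(G₀(q_{b₊} − q_{b₋}))(b₋)`**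
(row sources `g_{x,α} = ζ″(x,·)λ_α(x,·)f`, tails `q_x = (ζ″(x,·) − 1)f`; weights complete on the rows of both endpoints) — p31's
`gLocT_sub_mulVec_apply` at both endpoints, regrouped; any background, any `G₀`. [cite: BalabanImbrieJaffe1988, (2.31) p.263] -/
theorem covD_gLocT_sub_apply {j : ℕ} (c' : ℝ) (u : PBond P j → ℂ) (a' c'' : ℝ) (U : GaugeField P j U1) (k : ℕ) {ι : Type*} [Fintype ι]
    (cube : ι → Finset (Balaban1983to89.Site P j)) (lam : ι → Balaban1983to89.Site P j → Balaban1983to89.Site P j → ℝ)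
    (ζ'' : Balaban1983to89.Site P j → Balaban1983to89.Site P j → ℝ) (G₀ : Matrix (Balaban1983to89.Site P j) (Balaban1983to89.Site P j) ℂ)
    (f : Balaban1983to89.Site P j → ℂ) (b : PBond P j)
    (htgt : ∀ y, ζ'' b.tgt y ≠ 0 → ∑ α, lam α b.tgt y = 1) (hsrc : ∀ y, ζ'' b.src y ≠ 0 → ∑ α, lam α b.src y = 1) :
    covD c' u (gLocT a' c'' U k cube lam ζ'' *ᵥ f) b - covD c' u (G₀ *ᵥ f) b =
      ∑ α, (covD c' u (gBox a' c'' U k (cube α) *ᵥ fun y => (ζ'' b.tgt y : ℂ) * (lam α b.tgt y : ℂ) * f y) b -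
              covD c' u (G₀ *ᵥ fun y => (ζ'' b.tgt y : ℂ) * (lam α b.tgt y : ℂ) * f y) b) +
      ∑ α, (c' : ℂ) * ((gBox a' c'' U k (cube α) *ᵥ fun y =>
              ((ζ'' b.tgt y : ℂ) * (lam α b.tgt y : ℂ) - (ζ'' b.src y : ℂ) * (lam α b.src y : ℂ)) * f y) b.src -
            (G₀ *ᵥ fun y => ((ζ'' b.tgt y : ℂ) * (lam α b.tgt y : ℂ) - (ζ'' b.src y : ℂ) * (lam α b.src y : ℂ)) * f y) b.src) +
      covD c' u (G₀ *ᵥ fun y => ((ζ'' b.tgt y : ℂ) - 1) * f y) b +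
      (c' : ℂ) * (G₀ *ᵥ fun y => ((ζ'' b.tgt y : ℂ) - (ζ'' b.src y : ℂ)) * f y) b.src := by
  -- abbreviations for the sources
  set g' : ι → Balaban1983to89.Site P j → ℂ := fun α y => (ζ'' b.tgt y : ℂ) * (lam α b.tgt y : ℂ) * f y with hg'
  set g : ι → Balaban1983to89.Site P j → ℂ := fun α y => (ζ'' b.src y : ℂ) * (lam α b.src y : ℂ) * f y with hg
  set q' : Balaban1983to89.Site P j → ℂ := fun y => ((ζ'' b.tgt y : ℂ) - 1) * f y with hq'
  set q : Balaban1983to89.Site P j → ℂ := fun y => ((ζ'' b.src y : ℂ) - 1) * f y with hq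
  -- the difference sources are differences of sources
  have hdg : ∀ α, (fun y => ((ζ'' b.tgt y : ℂ) * (lam α b.tgt y : ℂ) - (ζ'' b.src y : ℂ) * (lam α b.src y : ℂ)) * f y) = g' α - g α := by
    intro α; funext y; simp only [hg', hg, Pi.sub_apply]; ring
  have hdq : (fun y => ((ζ'' b.tgt y : ℂ) - (ζ'' b.src y : ℂ)) * f y) = q' - q := by
    funext y; simp only [hq', hq, Pi.sub_apply]; ring
  -- p31's decomposition at both endpoints
  have e1 := gLocT_sub_mulVec_apply a' c'' U k cube lam ζ'' G₀ f b.tgt htgt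
  have e2 := gLocT_sub_mulVec_apply a' c'' U k cube lam ζ'' G₀ f b.src hsrc
  simp only [hdg, hdq]
  simp only [covD, Matrix.mulVec_sub, Pi.sub_apply]
  -- regroup: the `x`-values of the `b₊`-sources cancel between the first two sums
  have hpair : ∀ α, ((c' : ℂ) * (u b * (gBox a' c'' U k (cube α) *ᵥ g' α) b.tgt - (gBox a' c'' U k (cube α) *ᵥ g' α) b.src) -
        (c' : ℂ) * (u b * (G₀ *ᵥ g' α) b.tgt - (G₀ *ᵥ g' α) b.src)) +
      (c' : ℂ) * ((gBox a' c'' U k (cube α) *ᵥ g' α) b.src - (gBox a' c'' U k (cube α) *ᵥ g α) b.src -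
        ((G₀ *ᵥ g' α) b.src - (G₀ *ᵥ g α) b.src)) =
      (c' : ℂ) * u b * ((gBox a' c'' U k (cube α) *ᵥ g' α) b.tgt - (G₀ *ᵥ g' α) b.tgt) -
        (c' : ℂ) * ((gBox a' c'' U k (cube α) *ᵥ g α) b.src - (G₀ *ᵥ g α) b.src) := by
    intro α; ring
  rw [← Finset.sum_add_distrib, Finset.sum_congr rfl fun α _ => hpair α, Finset.sum_sub_distrib, ← Finset.mul_sum, ← Finset.mul_sum]
  have e1' : (gLocT a' c'' U k cube lam ζ'' *ᵥ f) b.tgt - (G₀ *ᵥ f) b.tgt =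
      ∑ α, ((gBox a' c'' U k (cube α) *ᵥ g' α) b.tgt - (G₀ *ᵥ g' α) b.tgt) + (G₀ *ᵥ q') b.tgt := by
    rw [e1]; simp only [Matrix.sub_mulVec, Pi.sub_apply, hg', hq']
  have e2' : (gLocT a' c'' U k cube lam ζ'' *ᵥ f) b.src - (G₀ *ᵥ f) b.src =
      ∑ α, ((gBox a' c'' U k (cube α) *ᵥ g α) b.src - (G₀ *ᵥ g α) b.src) + (G₀ *ᵥ q) b.src := by
    rw [e2]; simp only [Matrix.sub_mulVec, Pi.sub_apply, hg, hq]
  have hS1 : ∑ α, ((gBox a' c'' U k (cube α) *ᵥ g' α) b.tgt - (G₀ *ᵥ g' α) b.tgt) =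
      (gLocT a' c'' U k cube lam ζ'' *ᵥ f) b.tgt - (G₀ *ᵥ f) b.tgt - (G₀ *ᵥ q') b.tgt := by rw [e1']; ring
  have hS2 : ∑ α, ((gBox a' c'' U k (cube α) *ᵥ g α) b.src - (G₀ *ᵥ g α) b.src) =
      (gLocT a' c'' U k cube lam ζ'' *ᵥ f) b.src - (G₀ *ᵥ f) b.src - (G₀ *ᵥ q) b.src := by rw [e2']; ring
  rw [hS1, hS2]
  ring

variable {R₀ R₁ : ℝ}

/-- kernel: the tail source `q_x(y) = (ζ″(x,y) − 1)f(y)` is bounded by `‖f‖_∞` (`0 ≤ ζ″ ≤ 1`). [cite: BalabanImbrieJaffe1988, (2.29) p.263] -/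
theorem norm_tail_le (x : Balaban1983to89.Site P 0) {f : Balaban1983to89.Site P 0 → ℂ} {F : ℝ} (hF : ∀ y, ‖f y‖ ≤ F)
    (y : Balaban1983to89.Site P 0) :
    ‖((cutoff R₁ R₀ (B5Ineq137Torus.T P 0) x y : ℂ) - 1) * f y‖ ≤ F := by
  have hz1 : ‖(cutoff R₁ R₀ (B5Ineq137Torus.T P 0) x y : ℂ) - 1‖ ≤ 1 := by
    rw [← Complex.ofReal_one, ← Complex.ofReal_sub, Complex.norm_real, Real.norm_eq_abs, abs_le]
    constructor <;> linarith [cutoff_nonneg R₁ R₀ (B5Ineq137Torus.T P 0) x y, cutoff_le_one R₁ R₀ (B5Ineq137Torus.T P 0) x y]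
  calc ‖((cutoff R₁ R₀ (B5Ineq137Torus.T P 0) x y : ℂ) - 1) * f y‖ = ‖(cutoff R₁ R₀ (B5Ineq137Torus.T P 0) x y : ℂ) - 1‖ * ‖f y‖ :=
        norm_mul _ _
    _ ≤ 1 * F := mul_le_mul hz1 (hF y) (norm_nonneg _) zero_le_one
    _ = F := one_mul F

/-- kernel: the tail DIFFERENCE `(ζ″(x+e_μ,y) − ζ″(x,y))f(y)` is bounded by `(K/(R₀ − R₁))‖f‖_∞` (Lipschitz cut-off, one-step lemma).
[cite: BalabanImbrieJaffe1988, (2.29) p.263] -/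
theorem norm_tailDiff_le {K : ℝ} (hK0 : 0 ≤ K) (hR10 : R₁ < R₀)
    (hK : ∀ (a b a' b' : Balaban1983to89.Site P 0), |cutoff R₁ R₀ (B5Ineq137Torus.T P 0) a b - cutoff R₁ R₀ (B5Ineq137Torus.T P 0) a' b'| ≤
      K / (R₀ - R₁) * |B5Ineq137Torus.T P 0 a b - B5Ineq137Torus.T P 0 a' b'|)
    (x : Balaban1983to89.Site P 0) (μ : Fin P.d) {f : Balaban1983to89.Site P 0 → ℂ} {F : ℝ} (hF : ∀ y, ‖f y‖ ≤ F)
    (y : Balaban1983to89.Site P 0) :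
    ‖((cutoff R₁ R₀ (B5Ineq137Torus.T P 0) (x.shift μ) y : ℂ) - (cutoff R₁ R₀ (B5Ineq137Torus.T P 0) x y : ℂ)) * f y‖ ≤
      K / (R₀ - R₁) * F := by
  have hF0 : 0 ≤ F := (norm_nonneg _).trans (hF y)
  have hgap : 0 < R₀ - R₁ := sub_pos.2 hR10
  have hz : |cutoff R₁ R₀ (B5Ineq137Torus.T P 0) (x.shift μ) y - cutoff R₁ R₀ (B5Ineq137Torus.T P 0) x y| ≤ K / (R₀ - R₁) := by
    refine (hK _ _ _ _).trans ?_
    calc K / (R₀ - R₁) * |B5Ineq137Torus.T P 0 (x.shift μ) y - B5Ineq137Torus.T P 0 x y| ≤ K / (R₀ - R₁) * 1 :=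
          mul_le_mul_of_nonneg_left (abs_T_shift_sub_le x y μ) (by positivity)
      _ = K / (R₀ - R₁) := mul_one _
  rw [← Complex.ofReal_sub, norm_mul, Complex.norm_real, Real.norm_eq_abs]
  exact mul_le_mul hz (hF y) (norm_nonneg _) (by positivity)

/-- kernel: **where the tail `q_{x+e_μ}` lives**: if `(ζ″(x+e_μ,y) − 1)f(y) ≠ 0` then `f(y) ≠ 0` and `|x − y|_T > R₁ − 1` (`ζ″ = 1` within
`R₁` of `x + e_μ`, one-step lemma). [cite: BalabanImbrieJaffe1988, (2.29) p.263] -/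
theorem T_gt_of_tail_ne_zero (hR10 : R₁ < R₀) (x : Balaban1983to89.Site P 0) (μ : Fin P.d) {f : Balaban1983to89.Site P 0 → ℂ}
    {y : Balaban1983to89.Site P 0} (hne : ((cutoff R₁ R₀ (B5Ineq137Torus.T P 0) (x.shift μ) y : ℂ) - 1) * f y ≠ 0) :
    f y ≠ 0 ∧ R₁ - 1 < B5Ineq137Torus.T P 0 x y := by
  refine ⟨right_ne_zero_of_mul hne, ?_⟩
  have hz : cutoff R₁ R₀ (B5Ineq137Torus.T P 0) (x.shift μ) y ≠ 1 := by
    intro h1; exact hne (by rw [h1]; push_cast; ring)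
  have hgt : R₁ < B5Ineq137Torus.T P 0 (x.shift μ) y := lt_of_not_ge fun hle => hz (rowHyp_iii hR10 (x.shift μ) y hle)
  have h1 := abs_le.1 (abs_T_shift_sub_le x y μ)
  linarith

/-- kernel: **where the tail DIFFERENCE lives**: if `(ζ″(x+e_μ,y) − ζ″(x,y))f(y) ≠ 0` then `f(y) ≠ 0` and `|x − y|_T > R₁ − 1` (within `R₁ − 1`
of `x` both cut-offs equal `1`). [cite: BalabanImbrieJaffe1988, (2.29) p.263] -/
theorem T_gt_of_tailDiff_ne_zero (hR10 : R₁ < R₀) (x : Balaban1983to89.Site P 0) (μ : Fin P.d) {f : Balaban1983to89.Site P 0 → ℂ}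
    {y : Balaban1983to89.Site P 0}
    (hne : ((cutoff R₁ R₀ (B5Ineq137Torus.T P 0) (x.shift μ) y : ℂ) - (cutoff R₁ R₀ (B5Ineq137Torus.T P 0) x y : ℂ)) * f y ≠ 0) :
    f y ≠ 0 ∧ R₁ - 1 < B5Ineq137Torus.T P 0 x y := by
  refine ⟨right_ne_zero_of_mul hne, ?_⟩
  by_contra hle
  push Not at hle
  have h1 := abs_le.1 (abs_T_shift_sub_le x y μ)
  have hx : cutoff R₁ R₀ (B5Ineq137Torus.T P 0) x y = 1 := rowHyp_iii hR10 x y (by linarith)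
  have hx' : cutoff R₁ R₀ (B5Ineq137Torus.T P 0) (x.shift μ) y = 1 := rowHyp_iii hR10 (x.shift μ) y (by linarith)
  exact hne (by rw [hx, hx']; push_cast; ring)

end Identity

/-! ## §2 The covariant-derivative member of (2.31) at flat backgrounds FOR THE PRINTED DATA -/

section Deriv

/-- kernel: the label of a fine site over its own `k`-block site. [cite: BalabanImbrieJaffe1985, (2.4) p.302, dictionary] -/
private theorem mem_blockK_blkIter {k : ℕ} (x : Balaban1983to89.Site P 0) : x ∈ blockK k (blkIter k x) :=
  mem_blockK.2 rfl

/-- kernel: `e^{−δ'E} ≤ e^{−δE}` for `δ ≤ δ'`, `E ≥ 0`. [folklore] -/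
private theorem exp_le_exp_of_rate {δ δ' E : ℝ} (hδ : δ ≤ δ') (hE : 0 ≤ E) : Real.exp (-(δ' * E)) ≤ Real.exp (-(δ * E)) :=
  Real.exp_le_exp.2 (neg_le_neg (mul_le_mul_of_nonneg_right hδ hE))

/-- **THE COVARIANT-DERIVATIVE MEMBER OF (2.31) AT EVERY PURE-GAUGE BACKGROUND `u = 1^h`, FOR THE PRINTED LOCALIZATION DATA** (p. 263:
*"Bounds analogous to (2.30), (2.31) hold for covariant derivatives and Holder derivatives of G_{k,loc}(u) of order less than two"*, the
(2.31)-analogue for the covariant derivative).  THERE EXIST `δ₀, c₀ > 0` depending on `(d, ℓ, a)` only such that for every volume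
(`P.d = d+1`, `P.L = ℓ+1`), every `1 ≤ k ≤ K`, every no-wrap box `Ω₀ = c·L^k + Π_i[0, L^k·M₀_i)` shorter than the torus and leaving a torus gap
`≥ R`, every cube spacing `s ≥ 1` and half-width `W ≥ 2s/3 + R₀/2 + R`, radii `1 < R`, `0 ≤ R₁ < R₀`, every pure gauge `h`, every bond
`b = ⟨x, x + e_μ⟩` of the fine torus with both endpoints in `Ω₀` at chart depth `≥ R₀` (print's *"dist(x,Ω^c) ≧ O(r(e_k))"*), and every source
`f` with `‖f‖_∞ ≤ F` supported at sup-torus distance `≥ D ≥ 0` from `x`: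
`‖D^ε_{1^h}(G_{k,loc}(1^h)f)(b) − D^ε_{1^h}(G_k(Ω₀,1^h)f)(b)‖ ≤
 (L^kε)·c₀·[m·(1 + L^k((R₀−R₁)⁻¹ + s⁻¹))·e^{−δ₀(2R−1)/L^k} + (1 + L^k(R₀−R₁)⁻¹)·e^{−(δ₀/2)(R₁−1)/L^k}]·e^{−(δ₀/2)D/L^k}·F`,
`m = (⌊(L^k − 1 + R₀)/s⌋ + 3)^{d+1}`, where `G_{k,loc}(1^h)` is built from the torus cubes, the weights of (2.27) and the cut-off of (2.29) of
gen 26 and `D^ε_u φ(b) = ε⁻¹(u(b)φ(b₊) − φ(b₋))` — at the printed radii the bracket is print's `e^{−cr(e_k)}`. [cite: BalabanImbrieJaffe1988, (2.31) p.263] -/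
theorem deriv231_flat_cwt (d ℓ : ℕ) (hℓ : 1 ≤ ℓ) {a : ℝ} (ha : 0 < a) :
    ∃ δ₀ c₀ : ℝ, 0 < δ₀ ∧ 0 < c₀ ∧ ∀ (P : Params) (hPd : P.d = d + 1), P.L = ℓ + 1 →
      ∀ k : ℕ, 1 ≤ k → k ≤ P.K → ∀ (c M0 : Fin (d + 1) → ℕ), (∀ i, 1 ≤ M0 i) →
        (∀ i, c i * P.L ^ k + P.L ^ k * M0 i ≤ P.sitesPerDir 0) → (∀ i, P.L ^ k * M0 i < P.sitesPerDir 0) →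
      ∀ (s W : ℕ), 1 ≤ s → ∀ (R R₀ R₁ : ℝ), 1 < R → 0 ≤ R₁ → R₁ < R₀ → 2 * (s : ℝ) / 3 + R₀ / 2 + R ≤ W →
        (∀ i, ((P.L ^ k * M0 i : ℕ) : ℝ) + R ≤ P.sitesPerDir 0) →
      ∀ (h : GaugeTransf P 0 U1) (x : Balaban1983to89.Site P 0) (μ : Fin P.d),
        x ∈ (cubeT hPd (P.L ^ k) c fun i => P.L ^ k * M0 i) →
        (∀ i, R₀ ≤ (boxCoord hPd (P.L ^ k) c x i : ℝ) ∧ (boxCoord hPd (P.L ^ k) c x i : ℝ) + R₀ ≤ (P.L ^ k * M0 i : ℕ) - 1) →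
        x.shift μ ∈ (cubeT hPd (P.L ^ k) c fun i => P.L ^ k * M0 i) →
        (∀ i, R₀ ≤ (boxCoord hPd (P.L ^ k) c (x.shift μ) i : ℝ) ∧
          (boxCoord hPd (P.L ^ k) c (x.shift μ) i : ℝ) + R₀ ≤ (P.L ^ k * M0 i : ℕ) - 1) →
      ∀ (f : Balaban1983to89.Site P 0 → ℂ) (F D : ℝ), (∀ y, ‖f y‖ ≤ F) → 0 ≤ D → (∀ y, f y ≠ 0 → D ≤ B5Ineq137Torus.T P 0 x y) →
        ‖covD P.eps⁻¹ (cfg (gaugeAct h (1 : GaugeField P 0 U1)))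
              (gLocT (B1RG242Torus.α P a k * (P.L : ℝ) ^ (k * P.d)) P.eps⁻¹ (gaugeAct h (1 : GaugeField P 0 U1)) k
                (cubeFam hPd (P.L ^ k) c M0 s W) (lamFam hPd (P.L ^ k) c M0 s) (cutoff R₁ R₀ (B5Ineq137Torus.T P 0)) *ᵥ f) ⟨x, μ⟩ -
            covD P.eps⁻¹ (cfg (gaugeAct h (1 : GaugeField P 0 U1)))
              (gBox (B1RG242Torus.α P a k * (P.L : ℝ) ^ (k * P.d)) P.eps⁻¹ (gaugeAct h (1 : GaugeField P 0 U1)) k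
                (cubeT hPd (P.L ^ k) c fun i => P.L ^ k * M0 i) *ᵥ f) ⟨x, μ⟩‖ ≤
          P.spacing k * (c₀ * ((⌊(((P.L : ℝ) ^ k) - 1 + R₀) / s⌋₊ + 3) ^ (d + 1) * (1 + (P.L : ℝ) ^ k * ((R₀ - R₁)⁻¹ + (s : ℝ)⁻¹)) *
              Real.exp (-(δ₀ * (((P.L : ℝ) ^ k)⁻¹ * (2 * R - 1)))) +
            (1 + (P.L : ℝ) ^ k * (R₀ - R₁)⁻¹) * Real.exp (-(δ₀ / 2 * (((P.L : ℝ) ^ k)⁻¹ * (R₁ - 1))))) *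
            Real.exp (-(δ₀ / 2 * (((P.L : ℝ) ^ k)⁻¹ * D))) * F) := by
  obtain ⟨δ₁, c₁, hδ₁, hc₁, H1⟩ := close112_flat_cube_deriv_level d ℓ hℓ ha
  obtain ⟨δ₂, c₂, hδ₂, hc₂, H2⟩ := close112_flat_cube_level d ℓ hℓ ha
  obtain ⟨δ₃, c₃, hδ₃, hc₃, H3⟩ := decay110_flat_cube_deriv_level d ℓ hℓ ha
  obtain ⟨δ₄, c₄, hδ₄, hc₄, H4⟩ := decay110_flat_cube_level d ℓ hℓ ha
  obtain ⟨K, hK0, hK⟩ := exists_abs_cutoff_sub_le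
  set Λ₀ : ℝ := max K (3 * Real.pi * (d + 1 : ℕ) / 2) with hΛ₀def
  have hΛ₀0 : 0 ≤ Λ₀ := hK0.trans (le_max_left _ _)
  have hΛ₀K : K ≤ Λ₀ := le_max_left _ _
  set δ : ℝ := min (min δ₁ δ₂) (min δ₃ δ₄) with hδdef
  have hδ0 : 0 < δ := lt_min (lt_min hδ₁ hδ₂) (lt_min hδ₃ hδ₄)
  have hδ1 : δ ≤ δ₁ := (min_le_left _ _).trans (min_le_left _ _)
  have hδ2 : δ ≤ δ₂ := (min_le_left _ _).trans (min_le_right _ _)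
  have hδ3 : δ ≤ δ₃ := (min_le_right _ _).trans (min_le_left _ _)
  have hδ4 : δ ≤ δ₄ := (min_le_right _ _).trans (min_le_right _ _)
  set C : ℝ := max (max c₁ (2 * c₂ * Λ₀ + 1)) (max c₃ (c₄ * Λ₀ + 1)) with hCdef
  have hC1 : c₁ ≤ C := (le_max_left _ _).trans (le_max_left _ _)
  have hC2 : 2 * c₂ * Λ₀ + 1 ≤ C := (le_max_right _ _).trans (le_max_left _ _)
  have hC3 : c₃ ≤ C := (le_max_left _ _).trans (le_max_right _ _)
  have hC4 : c₄ * Λ₀ + 1 ≤ C := (le_max_right _ _).trans (le_max_right _ _)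
  have hC0 : 0 ≤ C := hc₁.le.trans hC1
  refine ⟨δ, C, hδ0, lt_of_lt_of_le hc₁ hC1, ?_⟩
  intro P hPd hPL k hk1 hkK c M0 hM0 hfit0 hN0 s W hs R R₀ R₁ hR hR₁ hR10 hW hgap h x μ hx hdeep hxe hdeepe f F D hF hD hsupp
  have hn : 1 ≤ P.L ^ k := Nat.one_le_pow _ _ P.L_pos
  have hk : 0 + k ≤ P.m + P.K := by omega
  have hR0 : 0 ≤ R := zero_le_one.trans hR.le
  have hR₀ : 0 ≤ R₀ := hR₁.trans hR10.le
  have hs0 : 0 < s := hs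
  have hsr : (0 : ℝ) < s := by exact_mod_cast hs0
  have hgap' : 0 < R₀ - R₁ := sub_pos.2 hR10
  have hLpos : (0 : ℝ) < P.L := P.cast_L_pos
  have hLk : (0 : ℝ) < (P.L : ℝ) ^ k := pow_pos hLpos _
  have hε : 0 < ((P.L : ℝ) ^ k)⁻¹ := inv_pos.mpr hLk
  have hF0 : 0 ≤ F := (norm_nonneg _).trans (hF x)
  have hsp0 : 0 < P.spacing k := P.spacing_pos k
  have heps : 0 < P.eps := P.eps_pos
  have hζ0 := cutoff_eq_zero_of_le (P := P) hR10
  -- abbreviations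
  set Ω₀ : Finset (Balaban1983to89.Site P 0) := cubeT hPd (P.L ^ k) c fun i => P.L ^ k * M0 i with hΩ₀def
  set A : ℝ := B1RG242Torus.α P a k * (P.L : ℝ) ^ (k * P.d) with hAdef
  set U : GaugeField P 0 U1 := gaugeAct h (1 : GaugeField P 0 U1) with hUdef
  set ζ := cutoff R₁ R₀ (B5Ineq137Torus.T P 0) with hζdef
  set x' := x.shift μ with hx'def
  set G₀ := gBox A P.eps⁻¹ U k Ω₀ with hG₀def
  set m : ℝ := ((⌊(((P.L : ℝ) ^ k) - 1 + R₀) / s⌋₊ : ℝ) + 3) ^ (d + 1) with hmdef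
  have hm0 : 0 ≤ m := by rw [hmdef]; positivity
  set E : ℝ := Real.exp (-(δ / 2 * (((P.L : ℝ) ^ k)⁻¹ * D))) with hEdef
  set E2R : ℝ := Real.exp (-(δ * (((P.L : ℝ) ^ k)⁻¹ * (2 * R - 1)))) with hE2Rdef
  set ER1 : ℝ := Real.exp (-(δ / 2 * (((P.L : ℝ) ^ k)⁻¹ * (R₁ - 1)))) with hER1def
  have hE0 : 0 < E := Real.exp_pos _
  have hE2R0 : 0 < E2R := Real.exp_pos _
  have hER10 : 0 < ER1 := Real.exp_pos _
  have hεD : 0 ≤ ((P.L : ℝ) ^ k)⁻¹ * D := mul_nonneg hε.le hD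
  have hε2R : 0 ≤ ((P.L : ℝ) ^ k)⁻¹ * (2 * R - 1) := mul_nonneg hε.le (by linarith)
  -- exponent bookkeeping: `e^{−δ_iD/L^k} ≤ E`-type facts
  have hED : ∀ {δ'}, δ ≤ δ' → Real.exp (-(δ' * (((P.L : ℝ) ^ k)⁻¹ * D))) ≤ E := by
    intro δ' hδ'
    refine (exp_le_exp_of_rate hδ' hεD).trans (Real.exp_le_exp.2 ?_)
    have := mul_nonneg hδ0.le hεD
    linarith
  have hE2 : ∀ {δ'}, δ ≤ δ' → Real.exp (-(δ' * (((P.L : ℝ) ^ k)⁻¹ * (R - 1 + R)))) ≤ E2R := by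
    intro δ' hδ'
    rw [show R - 1 + R = 2 * R - 1 by ring]
    exact exp_le_exp_of_rate hδ' hε2R
  set D' : ℝ := max D (R₁ - 1) with hD'def
  have hD'D : D ≤ D' := le_max_left _ _
  have hD'R : R₁ - 1 ≤ D' := le_max_right _ _
  have hED' : ∀ {δ'}, δ ≤ δ' → Real.exp (-(δ' * (((P.L : ℝ) ^ k)⁻¹ * D'))) ≤ E * ER1 := by
    intro δ' hδ'
    rw [hEdef, hER1def, ← Real.exp_add]
    refine Real.exp_le_exp.2 ?_
    have hD'0 : 0 ≤ ((P.L : ℝ) ^ k)⁻¹ * D' := mul_nonneg hε.le (hD.trans hD'D)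
    have h1 : δ * (((P.L : ℝ) ^ k)⁻¹ * D') ≤ δ' * (((P.L : ℝ) ^ k)⁻¹ * D') := mul_le_mul_of_nonneg_right hδ' hD'0
    have h2 : δ / 2 * (((P.L : ℝ) ^ k)⁻¹ * D) + δ / 2 * (((P.L : ℝ) ^ k)⁻¹ * (R₁ - 1)) ≤ δ * (((P.L : ℝ) ^ k)⁻¹ * D') := by
      have : D + (R₁ - 1) ≤ 2 * D' := by linarith
      calc δ / 2 * (((P.L : ℝ) ^ k)⁻¹ * D) + δ / 2 * (((P.L : ℝ) ^ k)⁻¹ * (R₁ - 1))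
          = δ / 2 * (((P.L : ℝ) ^ k)⁻¹ * (D + (R₁ - 1))) := by ring
        _ ≤ δ / 2 * (((P.L : ℝ) ^ k)⁻¹ * (2 * D')) :=
            mul_le_mul_of_nonneg_left (mul_le_mul_of_nonneg_left this hε.le) (by positivity)
        _ = δ * (((P.L : ℝ) ^ k)⁻¹ * D') := by ring
    linarith
  -- the sources
  set g' : ↥(labels (P.L ^ k) M0 s) → Balaban1983to89.Site P 0 → ℂ :=
    fun α y => (ζ x' y : ℂ) * (lamFam hPd (P.L ^ k) c M0 s α x' y : ℂ) * f y with hg'def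
  set dg : ↥(labels (P.L ^ k) M0 s) → Balaban1983to89.Site P 0 → ℂ :=
    fun α y => ((ζ x' y : ℂ) * (lamFam hPd (P.L ^ k) c M0 s α x' y : ℂ) - (ζ x y : ℂ) * (lamFam hPd (P.L ^ k) c M0 s α x y : ℂ)) * f y
    with hdgdef
  set q' : Balaban1983to89.Site P 0 → ℂ := fun y => ((ζ x' y : ℂ) - 1) * f y with hq'def
  set dq : Balaban1983to89.Site P 0 → ℂ := fun y => ((ζ x' y : ℂ) - (ζ x y : ℂ)) * f y with hdqdef
  -- the four-term identity (row hypothesis (i) at both endpoints)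
  have hid : covD P.eps⁻¹ (cfg U) (gLocT A P.eps⁻¹ U k (cubeFam hPd (P.L ^ k) c M0 s W) (lamFam hPd (P.L ^ k) c M0 s) ζ *ᵥ f) ⟨x, μ⟩ -
      covD P.eps⁻¹ (cfg U) (G₀ *ᵥ f) ⟨x, μ⟩ =
      ∑ α, (covD P.eps⁻¹ (cfg U) (gBox A P.eps⁻¹ U k (cubeFam hPd (P.L ^ k) c M0 s W α) *ᵥ g' α) ⟨x, μ⟩ -
              covD P.eps⁻¹ (cfg U) (G₀ *ᵥ g' α) ⟨x, μ⟩) +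
      ∑ α, ((P.eps⁻¹ : ℝ) : ℂ) * ((gBox A P.eps⁻¹ U k (cubeFam hPd (P.L ^ k) c M0 s W α) *ᵥ dg α) x - (G₀ *ᵥ dg α) x) +
      covD P.eps⁻¹ (cfg U) (G₀ *ᵥ q') ⟨x, μ⟩ + ((P.eps⁻¹ : ℝ) : ℂ) * (G₀ *ᵥ dq) x :=
    covD_gLocT_sub_apply P.eps⁻¹ (cfg U) A P.eps⁻¹ U k (cubeFam hPd (P.L ^ k) c M0 s W) (lamFam hPd (P.L ^ k) c M0 s) ζ G₀ f ⟨x, μ⟩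
      (rowHyp_i hPd hfit0 hζ0 hxe hdeepe) (rowHyp_i hPd hfit0 hζ0 hx hdeep)
  rw [hid]
  -- the active-label sets of the two endpoints
  set Sx : Finset ↥(labels (P.L ^ k) M0 s) := (activeLabels hPd (P.L ^ k) c s R₀ (blkIter k x)).subtype fun α => α ∈ labels (P.L ^ k) M0 s
    with hSxdef
  set Sx' : Finset ↥(labels (P.L ^ k) M0 s) := (activeLabels hPd (P.L ^ k) c s R₀ (blkIter k x')).subtype fun α => α ∈ labels (P.L ^ k) M0 s
    with hSx'def
  have hcardx : (Sx.card : ℝ) ≤ m := by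
    have h1 := card_subtype_activeLabels_le (hPd := hPd) (c := c) (M0 := M0) hn hs0 hR₀ (blkIter k x)
    have e : (((P.L ^ k : ℕ) : ℕ) : ℝ) = (P.L : ℝ) ^ k := by push_cast; rfl
    rw [hSxdef, hmdef]; rw [e] at h1; exact h1
  have hcardx' : (Sx'.card : ℝ) ≤ m := by
    have h1 := card_subtype_activeLabels_le (hPd := hPd) (c := c) (M0 := M0) hn hs0 hR₀ (blkIter k x')
    have e : (((P.L ^ k : ℕ) : ℕ) : ℝ) = (P.L : ℝ) ^ k := by push_cast; rfl
    rw [hSx'def, hmdef]; rw [e] at h1; exact h1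
  have hSx : ∀ (α : ↥(labels (P.L ^ k) M0 s)) (y : Balaban1983to89.Site P 0),
      ζ x y * lamFam hPd (P.L ^ k) c M0 s α x y ≠ 0 → α ∈ Sx := by
    intro α y hne
    rw [hSxdef, Finset.mem_subtype]
    exact mem_activeLabels_of_ne_zero_of_deep hk hs0 hfit0 hζ0 (mem_blockK_blkIter x) hdeep hne
  have hSx' : ∀ (α : ↥(labels (P.L ^ k) M0 s)) (y : Balaban1983to89.Site P 0),
      ζ x' y * lamFam hPd (P.L ^ k) c M0 s α x' y ≠ 0 → α ∈ Sx' := by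
    intro α y hne
    rw [hSx'def, Finset.mem_subtype]
    exact mem_activeLabels_of_ne_zero_of_deep hk hs0 hfit0 hζ0 (mem_blockK_blkIter x') hdeepe hne
  have hcardU : ((Sx ∪ Sx').card : ℝ) ≤ 2 * m := by
    have h1 : ((Sx ∪ Sx').card : ℝ) ≤ (Sx.card : ℝ) + (Sx'.card : ℝ) := by exact_mod_cast Finset.card_union_le _ _
    linarith
  -- geometry of an active cube: both endpoints and the active sources inside, `Ω₀ ∖ □_α` far
  have hstep : B5Ineq137Torus.T P 0 x' x ≤ 1 := by rw [B5Ineq137Torus.T_symm]; exact T_shift_le_one x μ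
  have hgeo' : ∀ (α : ↥(labels (P.L ^ k) M0 s)) (y₀ : Balaban1983to89.Site P 0), ζ x' y₀ * lamFam hPd (P.L ^ k) c M0 s α x' y₀ ≠ 0 →
      x ∈ cubeFam hPd (P.L ^ k) c M0 s W α ∧ x' ∈ cubeFam hPd (P.L ^ k) c M0 s W α ∧
      (∀ w ∈ Ω₀, w ∉ cubeFam hPd (P.L ^ k) c M0 s W α → R - 1 ≤ B5Ineq137Torus.T P 0 x w) := by
    intro α y₀ hy₀
    obtain ⟨hx'α, -, hfar⟩ := rowHyp_ii hPd hn hs0 hfit0 hR0 hgap hW hζ0 hxe hdeepe α y₀ hy₀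
    have hxα : x ∈ cubeFam hPd (P.L ^ k) c M0 s W α := by
      by_contra hnot
      have h1 := (hfar x hx hnot).1
      linarith
    refine ⟨hxα, hx'α, fun w hw hnot => ?_⟩
    have h1 := (hfar w hw hnot).1
    have h2 := abs_le.1 (abs_T_shift_sub_le x w μ)
    linarith
  have hgeo : ∀ (α : ↥(labels (P.L ^ k) M0 s)) (y₀ : Balaban1983to89.Site P 0), ζ x y₀ * lamFam hPd (P.L ^ k) c M0 s α x y₀ ≠ 0 →
      x ∈ cubeFam hPd (P.L ^ k) c M0 s W α ∧
      (∀ w ∈ Ω₀, w ∉ cubeFam hPd (P.L ^ k) c M0 s W α → R - 1 ≤ B5Ineq137Torus.T P 0 x w) := by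
    intro α y₀ hy₀
    obtain ⟨hxα, -, hfar⟩ := rowHyp_ii hPd hn hs0 hfit0 hR0 hgap hW hζ0 hx hdeep α y₀ hy₀
    exact ⟨hxα, fun w hw hnot => by linarith [(hfar w hw hnot).1]⟩
  have hζabs : ∀ z y, |ζ z y| ≤ 1 := fun z y => by
    rw [hζdef, abs_of_nonneg (cutoff_nonneg _ _ _ _ _)]; exact cutoff_le_one _ _ _ _ _
  -- TERM 1: [6] (1.11)–(1.12) derivative member for the cubes active at `x'`
  set B₁ : ℝ := P.spacing k * (c₁ * Real.exp (-(δ₁ * (((P.L : ℝ) ^ k)⁻¹ * D))) *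
    Real.exp (-(δ₁ * (((P.L : ℝ) ^ k)⁻¹ * (R - 1 + R)))) * F) with hB₁def
  have hB₁0 : 0 ≤ B₁ := by positivity
  have hterm1 : ∀ α, ‖covD P.eps⁻¹ (cfg U) (gBox A P.eps⁻¹ U k (cubeFam hPd (P.L ^ k) c M0 s W α) *ᵥ g' α) ⟨x, μ⟩ -
      covD P.eps⁻¹ (cfg U) (G₀ *ᵥ g' α) ⟨x, μ⟩‖ ≤ B₁ := by
    intro α
    by_cases hex : ∃ y, ζ x' y * lamFam hPd (P.L ^ k) c M0 s α x' y ≠ 0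
    · obtain ⟨y₀, hy₀⟩ := hex
      obtain ⟨hxα, hx'α, hfarx⟩ := hgeo' α y₀ hy₀
      obtain ⟨t, M', hM', hnest, hcα⟩ := cubeFam_nested (hPd := hPd) (n := P.L ^ k) (c := c) (s := s) (W := W) hM0 α
      have hsuppα : ∀ y, y ∉ cubeFam hPd (P.L ^ k) c M0 s W α → g' α y = 0 := by
        intro y hy
        by_contra hne
        exact hy (rowHyp_ii hPd hn hs0 hfit0 hR0 hgap hW hζ0 hxe hdeepe α y (rowSource_ne_zero hne).1).2.1
      have hDf : ∀ y, g' α y ≠ 0 → ∀ w ∈ Ω₀, w ∉ cubeFam hPd (P.L ^ k) c M0 s W α → R ≤ B5Ineq137Torus.T P 0 y w :=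
        fun y hy w hw hw' => ((rowHyp_ii hPd hn hs0 hfit0 hR0 hgap hW hζ0 hxe hdeepe α y (rowSource_ne_zero hy).1).2.2 w hw hw').2
      rw [hcα] at hxα hx'α hfarx hsuppα hDf ⊢
      exact H1 P hPd hPL k hk1 hkK c M0 t M' hM' hnest hfit0 hN0 h x μ hxα hx'α (g' α) F D (R - 1) R
        (fun y => norm_rowSource_le (hζabs x' y) (abs_lam_le_one (sum_abs_lamT_le_one hfit0) α x' y) hF y)
        hsuppα (fun y hy => hsupp y (rowSource_ne_zero hy).2) hfarx hDf
    · push Not at hex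
      have h0 : g' α = 0 := by
        funext y; rw [hg'def]; dsimp only; rw [← Complex.ofReal_mul, hex y, Complex.ofReal_zero, zero_mul]; rfl
      rw [h0, mulVec_zero, mulVec_zero]
      simp only [covD, Pi.zero_apply, mul_zero, sub_zero, norm_zero]
      exact hB₁0
  have hzero1 : ∀ α, α ∉ Sx' → covD P.eps⁻¹ (cfg U) (gBox A P.eps⁻¹ U k (cubeFam hPd (P.L ^ k) c M0 s W α) *ᵥ g' α) ⟨x, μ⟩ -
      covD P.eps⁻¹ (cfg U) (G₀ *ᵥ g' α) ⟨x, μ⟩ = 0 := by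
    intro α hα
    have h0 : g' α = 0 := by
      funext y
      by_contra hne
      exact hα (hSx' α y (rowSource_ne_zero hne).1)
    rw [h0, mulVec_zero, mulVec_zero]
    simp only [covD, Pi.zero_apply, mul_zero, sub_zero]
  have hsum1 : ‖∑ α, (covD P.eps⁻¹ (cfg U) (gBox A P.eps⁻¹ U k (cubeFam hPd (P.L ^ k) c M0 s W α) *ᵥ g' α) ⟨x, μ⟩ -
      covD P.eps⁻¹ (cfg U) (G₀ *ᵥ g' α) ⟨x, μ⟩)‖ ≤ m * B₁ := by
    rw [← Finset.sum_subset (Finset.subset_univ Sx') (fun α _ hα => hzero1 α hα)]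
    calc ‖∑ α ∈ Sx', (covD P.eps⁻¹ (cfg U) (gBox A P.eps⁻¹ U k (cubeFam hPd (P.L ^ k) c M0 s W α) *ᵥ g' α) ⟨x, μ⟩ -
            covD P.eps⁻¹ (cfg U) (G₀ *ᵥ g' α) ⟨x, μ⟩)‖
        ≤ ∑ α ∈ Sx', ‖covD P.eps⁻¹ (cfg U) (gBox A P.eps⁻¹ U k (cubeFam hPd (P.L ^ k) c M0 s W α) *ᵥ g' α) ⟨x, μ⟩ -
            covD P.eps⁻¹ (cfg U) (G₀ *ᵥ g' α) ⟨x, μ⟩‖ := norm_sum_le _ _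
      _ ≤ ∑ α ∈ Sx', B₁ := Finset.sum_le_sum fun α _ => hterm1 α
      _ = Sx'.card * B₁ := by rw [Finset.sum_const, nsmul_eq_mul]
      _ ≤ m * B₁ := mul_le_mul_of_nonneg_right hcardx' hB₁0
  -- TERM 2: [6] (1.11)–(1.12) value member on the difference sources, cubes active at `x` or `x'`
  set Λ : ℝ := K / (R₀ - R₁) + 3 * Real.pi * (d + 1 : ℕ) / (2 * s) with hΛdef
  have hΛ0 : 0 ≤ Λ := by rw [hΛdef]; positivity
  set B₂ : ℝ := P.spacing k ^ 2 * (c₂ * Real.exp (-(δ₂ * (((P.L : ℝ) ^ k)⁻¹ * D))) *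
    Real.exp (-(δ₂ * (((P.L : ℝ) ^ k)⁻¹ * (R - 1 + R)))) * (Λ * F)) with hB₂def
  have hB₂0 : 0 ≤ B₂ := by positivity
  have hterm2 : ∀ α, ‖(gBox A P.eps⁻¹ U k (cubeFam hPd (P.L ^ k) c M0 s W α) *ᵥ dg α) x - (G₀ *ᵥ dg α) x‖ ≤ B₂ := by
    intro α
    by_cases hex : ∃ y, dg α y ≠ 0
    · obtain ⟨y₀, hy₀⟩ := hex
      -- an active pair at one endpoint: `x` is in the cube and `Ω₀ ∖ □_α` is `≥ R − 1` away from `x`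
      have hact : ∀ y, dg α y ≠ 0 → ζ x' y * lamFam hPd (P.L ^ k) c M0 s α x' y ≠ 0 ∨ ζ x y * lamFam hPd (P.L ^ k) c M0 s α x y ≠ 0 := by
        intro y hy
        by_contra hno
        rw [not_or, not_not, not_not] at hno
        apply hy
        rw [hdgdef]; dsimp only
        rw [← Complex.ofReal_mul, ← Complex.ofReal_mul, hno.1, hno.2]; simp
      have hxfar : x ∈ cubeFam hPd (P.L ^ k) c M0 s W α ∧
          ∀ w ∈ Ω₀, w ∉ cubeFam hPd (P.L ^ k) c M0 s W α → R - 1 ≤ B5Ineq137Torus.T P 0 x w := by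
        rcases hact y₀ hy₀ with h1 | h1
        · exact ⟨(hgeo' α y₀ h1).1, (hgeo' α y₀ h1).2.2⟩
        · exact hgeo α y₀ h1
      obtain ⟨hxα, hfarx⟩ := hxfar
      obtain ⟨t, M', hM', hnest, hcα⟩ := cubeFam_nested (hPd := hPd) (n := P.L ^ k) (c := c) (s := s) (W := W) hM0 α
      have hsuppα : ∀ y, y ∉ cubeFam hPd (P.L ^ k) c M0 s W α → dg α y = 0 := by
        intro y hy
        by_contra hne
        rcases hact y hne with h1 | h1
        · exact hy (rowHyp_ii hPd hn hs0 hfit0 hR0 hgap hW hζ0 hxe hdeepe α y h1).2.1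
        · exact hy (rowHyp_ii hPd hn hs0 hfit0 hR0 hgap hW hζ0 hx hdeep α y h1).2.1
      have hDf : ∀ y, dg α y ≠ 0 → ∀ w ∈ Ω₀, w ∉ cubeFam hPd (P.L ^ k) c M0 s W α → R ≤ B5Ineq137Torus.T P 0 y w := by
        intro y hy w hw hw'
        rcases hact y hy with h1 | h1
        · exact ((rowHyp_ii hPd hn hs0 hfit0 hR0 hgap hW hζ0 hxe hdeepe α y h1).2.2 w hw hw').2
        · exact ((rowHyp_ii hPd hn hs0 hfit0 hR0 hgap hW hζ0 hx hdeep α y h1).2.2 w hw hw').2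
      rw [hcα] at hxα hfarx hsuppα hDf ⊢
      exact H2 P hPd hPL k hk1 hkK c M0 t M' hM' hnest hfit0 hN0 h x hxα (dg α) (Λ * F) D (R - 1) R
        (fun y => norm_rowSource_sub_le hPd hs0 hfit0 hN0 hK0 hR10 (hK R₁ R₀ hR10 (B5Ineq137Torus.T P 0)) α.1 hx hxe hF y)
        hsuppα (fun y hy => hsupp y (right_ne_zero_of_mul hy)) hfarx hDf
    · push Not at hex
      have h0 : dg α = 0 := funext hex
      rw [h0, mulVec_zero, mulVec_zero, Pi.zero_apply, sub_zero, norm_zero]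
      exact hB₂0
  have hzero2 : ∀ α, α ∉ Sx ∪ Sx' → (gBox A P.eps⁻¹ U k (cubeFam hPd (P.L ^ k) c M0 s W α) *ᵥ dg α) x - (G₀ *ᵥ dg α) x = 0 := by
    intro α hα
    rw [Finset.mem_union, not_or] at hα
    have h0 : dg α = 0 := by
      funext y
      rw [hdgdef]; dsimp only
      have h1 : ζ x' y * lamFam hPd (P.L ^ k) c M0 s α x' y = 0 := by
        by_contra hne; exact hα.2 (hSx' α y hne)
      have h2 : ζ x y * lamFam hPd (P.L ^ k) c M0 s α x y = 0 := by
        by_contra hne; exact hα.1 (hSx α y hne)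
      rw [← Complex.ofReal_mul, ← Complex.ofReal_mul, h1, h2]; simp
    rw [h0, mulVec_zero, mulVec_zero, Pi.zero_apply, sub_zero]
  have hsum2 : ‖∑ α, ((P.eps⁻¹ : ℝ) : ℂ) * ((gBox A P.eps⁻¹ U k (cubeFam hPd (P.L ^ k) c M0 s W α) *ᵥ dg α) x - (G₀ *ᵥ dg α) x)‖ ≤
      P.eps⁻¹ * (2 * m * B₂) := by
    rw [← Finset.mul_sum, norm_mul, Complex.norm_real, Real.norm_eq_abs, abs_of_pos (inv_pos.mpr heps)]
    refine mul_le_mul_of_nonneg_left ?_ (inv_pos.mpr heps).le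
    rw [← Finset.sum_subset (Finset.subset_univ (Sx ∪ Sx')) (fun α _ hα => hzero2 α hα)]
    calc ‖∑ α ∈ Sx ∪ Sx', ((gBox A P.eps⁻¹ U k (cubeFam hPd (P.L ^ k) c M0 s W α) *ᵥ dg α) x - (G₀ *ᵥ dg α) x)‖
        ≤ ∑ α ∈ Sx ∪ Sx', ‖(gBox A P.eps⁻¹ U k (cubeFam hPd (P.L ^ k) c M0 s W α) *ᵥ dg α) x - (G₀ *ᵥ dg α) x‖ := norm_sum_le _ _
      _ ≤ ∑ α ∈ Sx ∪ Sx', B₂ := Finset.sum_le_sum fun α _ => hterm2 α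
      _ = (Sx ∪ Sx').card * B₂ := by rw [Finset.sum_const, nsmul_eq_mul]
      _ ≤ 2 * m * B₂ := mul_le_mul_of_nonneg_right hcardU hB₂0
  -- TERM 3: [6] (1.10) derivative member on the box for the tail `q'`
  set B₃ : ℝ := P.spacing k * (c₃ * Real.exp (-(δ₃ * (((P.L : ℝ) ^ k)⁻¹ * D'))) * F) with hB₃def
  have hterm3 : ‖covD P.eps⁻¹ (cfg U) (G₀ *ᵥ q') ⟨x, μ⟩‖ ≤ B₃ := by
    rw [hG₀def, hΩ₀def]
    refine H3 P hPd hPL k hk1 hkK c M0 hM0 hfit0 hN0 h x q' F D' (fun y => norm_tail_le x' hF y) (fun y hy => ?_) μ hx hxe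
    obtain ⟨hf, hT⟩ := T_gt_of_tail_ne_zero hR10 x μ hy
    exact max_le (hsupp y hf) hT.le
  -- TERM 4: [6] (1.10) value member on the box for the tail difference `dq`
  set B₄ : ℝ := P.spacing k ^ 2 * (c₄ * Real.exp (-(δ₄ * (((P.L : ℝ) ^ k)⁻¹ * D'))) * (K / (R₀ - R₁) * F)) with hB₄def
  have hterm4 : ‖((P.eps⁻¹ : ℝ) : ℂ) * (G₀ *ᵥ dq) x‖ ≤ P.eps⁻¹ * B₄ := by
    rw [norm_mul, Complex.norm_real, Real.norm_eq_abs, abs_of_pos (inv_pos.mpr heps)]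
    refine mul_le_mul_of_nonneg_left ?_ (inv_pos.mpr heps).le
    rw [hG₀def, hΩ₀def]
    refine H4 P hPd hPL k hk1 hkK c M0 hM0 hfit0 hN0 h x dq (K / (R₀ - R₁) * F) D'
      (fun y => norm_tailDiff_le hK0 hR10 (hK R₁ R₀ hR10 (B5Ineq137Torus.T P 0)) x μ hF y) (fun y hy => ?_)
    obtain ⟨hf, hT⟩ := T_gt_of_tailDiff_ne_zero hR10 x μ hy
    exact max_le (hsupp y hf) hT.le
  -- assembling
  have hscale : P.eps⁻¹ * P.spacing k ^ 2 = P.spacing k * (P.L : ℝ) ^ k := by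
    rw [Params.spacing]
    field_simp
  have hΛle : Λ ≤ Λ₀ * ((R₀ - R₁)⁻¹ + (s : ℝ)⁻¹) := by
    rw [hΛdef, mul_add]
    refine add_le_add ?_ ?_
    · rw [div_eq_mul_inv]
      exact mul_le_mul_of_nonneg_right (le_max_left _ _) (inv_pos.mpr hgap').le
    · have e : 3 * Real.pi * (d + 1 : ℕ) / (2 * s) = (3 * Real.pi * (d + 1 : ℕ) / 2) * (s : ℝ)⁻¹ := by
        field_simp
      rw [e]
      exact mul_le_mul_of_nonneg_right (le_max_right _ _) (inv_pos.mpr hsr).le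
  have hKle : K / (R₀ - R₁) ≤ Λ₀ * (R₀ - R₁)⁻¹ := by
    rw [div_eq_mul_inv]; exact mul_le_mul_of_nonneg_right hΛ₀K (inv_pos.mpr hgap').le
  -- term 1 ≤ spacing·(C·m·E2R·E·F)
  have h1 : m * B₁ ≤ P.spacing k * (C * (m * 1 * E2R) * E * F) := by
    have : B₁ ≤ P.spacing k * (C * E2R * E * F) := by
      rw [hB₁def]
      refine mul_le_mul_of_nonneg_left ?_ hsp0.le
      have := mul_le_mul (mul_le_mul hC1 (hED hδ1) (Real.exp_pos _).le hC0) (hE2 hδ1) (Real.exp_pos _).le (by positivity)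
      calc c₁ * Real.exp (-(δ₁ * (((P.L : ℝ) ^ k)⁻¹ * D))) * Real.exp (-(δ₁ * (((P.L : ℝ) ^ k)⁻¹ * (R - 1 + R)))) * F
          ≤ C * E * E2R * F := mul_le_mul_of_nonneg_right this hF0
        _ = C * E2R * E * F := by ring
    calc m * B₁ ≤ m * (P.spacing k * (C * E2R * E * F)) := mul_le_mul_of_nonneg_left this hm0
      _ = P.spacing k * (C * (m * 1 * E2R) * E * F) := by ring
  -- term 2 ≤ spacing·(C·m·L^k((R₀−R₁)⁻¹ + s⁻¹)·E2R·E·F)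
  have h2 : P.eps⁻¹ * (2 * m * B₂) ≤ P.spacing k * (C * (m * ((P.L : ℝ) ^ k * ((R₀ - R₁)⁻¹ + (s : ℝ)⁻¹)) * E2R) * E * F) := by
    have e : P.eps⁻¹ * (2 * m * B₂) = P.spacing k * ((2 * c₂ * Λ) * m * (P.L : ℝ) ^ k *
        (Real.exp (-(δ₂ * (((P.L : ℝ) ^ k)⁻¹ * D))) * Real.exp (-(δ₂ * (((P.L : ℝ) ^ k)⁻¹ * (R - 1 + R))))) * F) := by
      rw [hB₂def]
      have : P.eps⁻¹ * (2 * m * (P.spacing k ^ 2 * (c₂ * Real.exp (-(δ₂ * (((P.L : ℝ) ^ k)⁻¹ * D))) *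
          Real.exp (-(δ₂ * (((P.L : ℝ) ^ k)⁻¹ * (R - 1 + R)))) * (Λ * F)))) =
          (P.eps⁻¹ * P.spacing k ^ 2) * (2 * c₂ * Λ * m *
            (Real.exp (-(δ₂ * (((P.L : ℝ) ^ k)⁻¹ * D))) * Real.exp (-(δ₂ * (((P.L : ℝ) ^ k)⁻¹ * (R - 1 + R))))) * F) := by ring
      rw [this, hscale]; ring
    rw [e]
    refine mul_le_mul_of_nonneg_left ?_ hsp0.le
    have hcoef : 2 * c₂ * Λ * m * (P.L : ℝ) ^ k ≤ C * (m * ((P.L : ℝ) ^ k * ((R₀ - R₁)⁻¹ + (s : ℝ)⁻¹))) := by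
      have h3 : 2 * c₂ * Λ ≤ C * ((R₀ - R₁)⁻¹ + (s : ℝ)⁻¹) := by
        calc 2 * c₂ * Λ ≤ 2 * c₂ * (Λ₀ * ((R₀ - R₁)⁻¹ + (s : ℝ)⁻¹)) := mul_le_mul_of_nonneg_left hΛle (by positivity)
          _ = (2 * c₂ * Λ₀) * ((R₀ - R₁)⁻¹ + (s : ℝ)⁻¹) := by ring
          _ ≤ C * ((R₀ - R₁)⁻¹ + (s : ℝ)⁻¹) := mul_le_mul_of_nonneg_right (by linarith) (by positivity)
      calc 2 * c₂ * Λ * m * (P.L : ℝ) ^ k = (2 * c₂ * Λ) * (m * (P.L : ℝ) ^ k) := by ring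
        _ ≤ (C * ((R₀ - R₁)⁻¹ + (s : ℝ)⁻¹)) * (m * (P.L : ℝ) ^ k) := mul_le_mul_of_nonneg_right h3 (by positivity)
        _ = C * (m * ((P.L : ℝ) ^ k * ((R₀ - R₁)⁻¹ + (s : ℝ)⁻¹))) := by ring
    have hexp : Real.exp (-(δ₂ * (((P.L : ℝ) ^ k)⁻¹ * D))) * Real.exp (-(δ₂ * (((P.L : ℝ) ^ k)⁻¹ * (R - 1 + R)))) ≤ E2R * E := by
      calc _ ≤ E * E2R := mul_le_mul (hED hδ2) (hE2 hδ2) (Real.exp_pos _).le hE0.le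
        _ = E2R * E := mul_comm _ _
    calc 2 * c₂ * Λ * m * (P.L : ℝ) ^ k *
          (Real.exp (-(δ₂ * (((P.L : ℝ) ^ k)⁻¹ * D))) * Real.exp (-(δ₂ * (((P.L : ℝ) ^ k)⁻¹ * (R - 1 + R))))) * F
        ≤ C * (m * ((P.L : ℝ) ^ k * ((R₀ - R₁)⁻¹ + (s : ℝ)⁻¹))) * (E2R * E) * F :=
          mul_le_mul_of_nonneg_right (mul_le_mul hcoef hexp (by positivity) (by positivity)) hF0
      _ = C * (m * ((P.L : ℝ) ^ k * ((R₀ - R₁)⁻¹ + (s : ℝ)⁻¹)) * E2R) * E * F := by ring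
  -- term 3 ≤ spacing·(C·1·ER1·E·F)
  have h3 : B₃ ≤ P.spacing k * (C * (1 * ER1) * E * F) := by
    rw [hB₃def]
    refine mul_le_mul_of_nonneg_left ?_ hsp0.le
    calc c₃ * Real.exp (-(δ₃ * (((P.L : ℝ) ^ k)⁻¹ * D'))) * F ≤ C * (E * ER1) * F :=
          mul_le_mul_of_nonneg_right (mul_le_mul hC3 (hED' hδ3) (Real.exp_pos _).le hC0) hF0
      _ = C * (1 * ER1) * E * F := by ring
  -- term 4 ≤ spacing·(C·L^k(R₀−R₁)⁻¹·ER1·E·F)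
  have h4 : P.eps⁻¹ * B₄ ≤ P.spacing k * (C * ((P.L : ℝ) ^ k * (R₀ - R₁)⁻¹ * ER1) * E * F) := by
    have e : P.eps⁻¹ * B₄ = P.spacing k * ((c₄ * (K / (R₀ - R₁))) * (P.L : ℝ) ^ k * Real.exp (-(δ₄ * (((P.L : ℝ) ^ k)⁻¹ * D'))) * F) := by
      rw [hB₄def]
      have : P.eps⁻¹ * (P.spacing k ^ 2 * (c₄ * Real.exp (-(δ₄ * (((P.L : ℝ) ^ k)⁻¹ * D'))) * (K / (R₀ - R₁) * F))) =
          (P.eps⁻¹ * P.spacing k ^ 2) * (c₄ * (K / (R₀ - R₁)) * Real.exp (-(δ₄ * (((P.L : ℝ) ^ k)⁻¹ * D'))) * F) := by ring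
      rw [this, hscale]; ring
    rw [e]
    refine mul_le_mul_of_nonneg_left ?_ hsp0.le
    have hcoef : c₄ * (K / (R₀ - R₁)) * (P.L : ℝ) ^ k ≤ C * ((P.L : ℝ) ^ k * (R₀ - R₁)⁻¹) := by
      have h5 : c₄ * (K / (R₀ - R₁)) ≤ C * (R₀ - R₁)⁻¹ := by
        calc c₄ * (K / (R₀ - R₁)) ≤ c₄ * (Λ₀ * (R₀ - R₁)⁻¹) := mul_le_mul_of_nonneg_left hKle hc₄.le
          _ = (c₄ * Λ₀) * (R₀ - R₁)⁻¹ := by ring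
          _ ≤ C * (R₀ - R₁)⁻¹ := mul_le_mul_of_nonneg_right (by linarith) (inv_pos.mpr hgap').le
      calc c₄ * (K / (R₀ - R₁)) * (P.L : ℝ) ^ k ≤ C * (R₀ - R₁)⁻¹ * (P.L : ℝ) ^ k := mul_le_mul_of_nonneg_right h5 hLk.le
        _ = C * ((P.L : ℝ) ^ k * (R₀ - R₁)⁻¹) := by ring
    calc c₄ * (K / (R₀ - R₁)) * (P.L : ℝ) ^ k * Real.exp (-(δ₄ * (((P.L : ℝ) ^ k)⁻¹ * D'))) * F
        ≤ C * ((P.L : ℝ) ^ k * (R₀ - R₁)⁻¹) * (E * ER1) * F :=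
          mul_le_mul_of_nonneg_right (mul_le_mul hcoef (hED' hδ4) (Real.exp_pos _).le (by positivity)) hF0
      _ = C * ((P.L : ℝ) ^ k * (R₀ - R₁)⁻¹ * ER1) * E * F := by ring
  refine ((norm_add_le _ _).trans (add_le_add ((norm_add_le _ _).trans (add_le_add ((norm_add_le _ _).trans
    (add_le_add hsum1 hsum2)) hterm3)) hterm4)).trans ?_
  calc m * B₁ + P.eps⁻¹ * (2 * m * B₂) + B₃ + P.eps⁻¹ * B₄
      ≤ P.spacing k * (C * (m * 1 * E2R) * E * F) + P.spacing k * (C * (m * ((P.L : ℝ) ^ k * ((R₀ - R₁)⁻¹ + (s : ℝ)⁻¹)) * E2R) * E * F) +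
        P.spacing k * (C * (1 * ER1) * E * F) + P.spacing k * (C * ((P.L : ℝ) ^ k * (R₀ - R₁)⁻¹ * ER1) * E * F) :=
        add_le_add (add_le_add (add_le_add h1 h2) h3) h4
    _ = P.spacing k * (C * (m * (1 + (P.L : ℝ) ^ k * ((R₀ - R₁)⁻¹ + (s : ℝ)⁻¹)) * E2R + (1 + (P.L : ℝ) ^ k * (R₀ - R₁)⁻¹) * ER1) * E * F) := by
        ring

end Deriv

end

end Literature.MathematicalPhysics.QuantumFieldTheory.BalabanImbrieJaffe1984to88.BIJ88LocDeriv231FlatTorus
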